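import Literature.NumberTheory.LFunctions.WeilTwoPrimeDeflL2Def
import Literature.NumberTheory.LFunctions.WeilTwoPrimeDeflL2DataPO24
import Literature.NumberTheory.LFunctions.WeilBlockRowsR
import HarnessLib

/-!
# Deflated two-prime certificate L2: the materialized odd block agrees with `P_r + Σ μ ĉ ĉᵀ`, rows 0–9

`WeilCert.checkPmRowG` for certificate L2 (odd block), by `decide +kernel`. Pure proof file; nothing is asserted.
-/

noncomputable section

namespace Literature.NumberTheory.LFunctions

set_option maxHeartbeats 0 in
/-- Row 0 of the materialized odd block is row 0 of `P_r + Σ μ ĉ ĉᵀ` (certificate L2). [folklore] -/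
theorem checkPmRowG1_0_weilCertDeflL2 : weilCertDeflL2Base.checkPmRowG weilCertDeflL2P weilCertDeflL2PmO 1 0 = true := by
  decide +kernel

set_option maxHeartbeats 0 in
/-- Row 1 of the materialized odd block is row 1 of `P_r + Σ μ ĉ ĉᵀ` (certificate L2). [folklore] -/
theorem checkPmRowG1_1_weilCertDeflL2 : weilCertDeflL2Base.checkPmRowG weilCertDeflL2P weilCertDeflL2PmO 1 1 = true := by
  decide +kernel

set_option maxHeartbeats 0 in
/-- Row 2 of the materialized odd block is row 2 of `P_r + Σ μ ĉ ĉᵀ` (certificate L2). [folklore] -/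
theorem checkPmRowG1_2_weilCertDeflL2 : weilCertDeflL2Base.checkPmRowG weilCertDeflL2P weilCertDeflL2PmO 1 2 = true := by
  decide +kernel

set_option maxHeartbeats 0 in
/-- Row 3 of the materialized odd block is row 3 of `P_r + Σ μ ĉ ĉᵀ` (certificate L2). [folklore] -/
theorem checkPmRowG1_3_weilCertDeflL2 : weilCertDeflL2Base.checkPmRowG weilCertDeflL2P weilCertDeflL2PmO 1 3 = true := by
  decide +kernel

set_option maxHeartbeats 0 in
/-- Row 4 of the materialized odd block is row 4 of `P_r + Σ μ ĉ ĉᵀ` (certificate L2). [folklore] -/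
theorem checkPmRowG1_4_weilCertDeflL2 : weilCertDeflL2Base.checkPmRowG weilCertDeflL2P weilCertDeflL2PmO 1 4 = true := by
  decide +kernel

set_option maxHeartbeats 0 in
/-- Row 5 of the materialized odd block is row 5 of `P_r + Σ μ ĉ ĉᵀ` (certificate L2). [folklore] -/
theorem checkPmRowG1_5_weilCertDeflL2 : weilCertDeflL2Base.checkPmRowG weilCertDeflL2P weilCertDeflL2PmO 1 5 = true := by
  decide +kernel

set_option maxHeartbeats 0 in
/-- Row 6 of the materialized odd block is row 6 of `P_r + Σ μ ĉ ĉᵀ` (certificate L2). [folklore] -/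
theorem checkPmRowG1_6_weilCertDeflL2 : weilCertDeflL2Base.checkPmRowG weilCertDeflL2P weilCertDeflL2PmO 1 6 = true := by
  decide +kernel

set_option maxHeartbeats 0 in
/-- Row 7 of the materialized odd block is row 7 of `P_r + Σ μ ĉ ĉᵀ` (certificate L2). [folklore] -/
theorem checkPmRowG1_7_weilCertDeflL2 : weilCertDeflL2Base.checkPmRowG weilCertDeflL2P weilCertDeflL2PmO 1 7 = true := by
  decide +kernel

set_option maxHeartbeats 0 in
/-- Row 8 of the materialized odd block is row 8 of `P_r + Σ μ ĉ ĉᵀ` (certificate L2). [folklore] -/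
theorem checkPmRowG1_8_weilCertDeflL2 : weilCertDeflL2Base.checkPmRowG weilCertDeflL2P weilCertDeflL2PmO 1 8 = true := by
  decide +kernel

set_option maxHeartbeats 0 in
/-- Row 9 of the materialized odd block is row 9 of `P_r + Σ μ ĉ ĉᵀ` (certificate L2). [folklore] -/
theorem checkPmRowG1_9_weilCertDeflL2 : weilCertDeflL2Base.checkPmRowG weilCertDeflL2P weilCertDeflL2PmO 1 9 = true := by
  decide +kernel


end Literature.NumberTheory.LFunctions
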